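import Mathlib
import Summits.NavierStokesRegularity.NavierStokesRegularity.Theorems.EulerZoomLiouvillePowerGaugeEulerLiouvilleSelfSimilarNoDriftTools
import HarnessLib.Audit

/-!
# Rung C1 of the crux `EulerZoomLiouville.PowerGaugeEulerLiouville`, NO-DRIFT lane (3c/3): TOOLS for verifying the bordered
# hypothesis at bad limit nodes (kernel vectors from accumulating zeros, isolated limit points, symmetric / simple-
# eigenvalue bordered operators)

Route №10 `EulerZoomLiouville` (NavierStokesRegularity), crux E = stmt-NavierStokesRegularity-19832, tenure rung C1,
registered residue `stub_selfSimilarExtremalRest`.  Lineage ns-typeII-p2 (gen 7).  Sequel of `…SelfSimilarNoDrift`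
(`tendsto_flow_atBot_of_bordered_clusterPt`): the bordered hypothesis «`DW(z₀) e = 0`, `DW(z₀) + ⟪e,·⟫e` invertible» is
VERIFIED at every limit node that is either ISOLATED in the stagnation set (then no hypothesis is needed: the
preconnected limit set is the point) or a NON-ISOLATED NON-VORTICAL BAD node (`curl V(z₀) = 0`, `⟪DV(z₀)w, w⟫ ≥ 1` for
a unit `w`): there `DW(z₀) = γI + DV(z₀)` is symmetric with trace `3γ` and top eigenvalue `≥ 1 + γ > 3γ`, so `0` is
at most a simple eigenvalue, while non-isolation supplies a unit kernel vector.

* `exists_unit_kernel_of_accumulating_zeros` — a zero of a differentiable map at which other zeros accumulate has a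
  unit kernel vector of the derivative (little-o + compactness of the unit sphere);
* `tendsto_of_isolated_mapClusterPt` — a curve with compact tail whose limit points lie in `N` and which has a limit
  point ISOLATED in `N` converges to it (the limit set is preconnected);
* `exists_borderedEquiv_of_isSymmetric` — symmetric `L`, `L e = 0`, `ker L ∩ e^⊥ = 0` ⇒ `L + ⟪e,·⟫e` invertible;
* `ker_inter_orth_eq_zero_of_bad` — symmetric `L` on `ℝ³` with `tr L = 3γ`, `0 < γ < ½` and a unit `w` with
  `⟪Lw, w⟫ ≥ 1 + γ`: two orthonormal kernel vectors are impossible;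
* `exists_borderedEquiv_of_eigen_simple` — on `ℝ³`: `A ω = λω` (`λ ≠ 0`), `A e = 0`, `tr A − λ ≠ 0` ⇒ `A + ⟪e,·⟫e`
  invertible (the VORTICAL node: `λ = 1+γ`, `tr = 3γ`, `μ = 2γ − 1 ≠ 0`).

Consumed by `…SelfSimilarNoDriftBadNode` (3d/3).  WHAT THIS IS NOT: not NS, not E, not rung C1 — linear algebra and
point-set topology. [folklore]
-/

noncomputable section

-- flat `Theorems/<Route><Decl>…` files of one crux share the namespace of the crux (tree convention)
set_option linter.dupNamespace false

open MeasureTheory Set Filter Topology Metric Function InnerProductSpace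
open scoped RealInnerProductSpace NNReal ContDiff

namespace Summit.NavierStokesRegularity.NavierStokesRegularity.Theorems.PowerGaugeEulerLiouville.NoDrift

/-! ### A unit kernel vector at an accumulation point of zeros -/

section Kernel

variable {F : Type*} [NormedAddCommGroup F] [NormedSpace ℝ F] [FiniteDimensional ℝ F]

/-- **Accumulating zeros give a kernel vector.**  If `W` is differentiable at its zero `z` with derivative `L` and
zeros of `W` other than `z` accumulate at `z`, then `L e = 0` for some unit vector `e` (finite dimension).
[folklore] -/
theorem exists_unit_kernel_of_accumulating_zeros {W : F → F} {z : F} {L : F →L[ℝ] F}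
    (hW : HasFDerivAt W L z) (hz : W z = 0) (hacc : ∀ r > 0, ∃ y, y ≠ z ∧ dist y z < r ∧ W y = 0)
    [Nontrivial F] : ∃ e : F, ‖e‖ = 1 ∧ L e = 0 := by
  -- for every `κ > 0` some unit vector has `‖L u‖ ≤ κ`
  have hsmall : ∀ κ > 0, ∃ u : F, ‖u‖ = 1 ∧ ‖L u‖ ≤ κ := by
    intro κ hκ
    have hlo := hW.isLittleO
    rw [Asymptotics.isLittleO_iff] at hlo
    have h := hlo hκ
    rw [Metric.eventually_nhds_iff] at h
    obtain ⟨r, hr, hball⟩ := h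
    obtain ⟨y, hyz, hdist, hWy⟩ := hacc r hr
    have hb := hball hdist
    rw [hWy, hz, sub_zero, zero_sub, norm_neg] at hb
    have hne : ‖y - z‖ ≠ 0 := by rw [norm_ne_zero_iff, sub_ne_zero]; exact hyz
    have hpos : 0 < ‖y - z‖ := (norm_nonneg _).lt_of_ne (Ne.symm hne)
    refine ⟨‖y - z‖⁻¹ • (y - z), by rw [norm_smul, norm_inv, norm_norm, inv_mul_cancel₀ hne], ?_⟩
    rw [map_smul, norm_smul, norm_inv, norm_norm]
    calc ‖y - z‖⁻¹ * ‖L (y - z)‖ ≤ ‖y - z‖⁻¹ * (κ * ‖y - z‖) :=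
          mul_le_mul_of_nonneg_left hb (inv_nonneg.2 (norm_nonneg _))
      _ = κ := by field_simp
  -- minimise `‖L u‖` over the compact unit sphere
  have hsc : IsCompact (sphere (0 : F) 1) := isCompact_sphere 0 1
  have hsne : (sphere (0 : F) 1).Nonempty := (NormedSpace.sphere_nonempty).2 zero_le_one
  obtain ⟨u, hu, hmin⟩ := hsc.exists_isMinOn hsne (continuous_norm.comp L.continuous).continuousOn
  refine ⟨u, by simpa using hu, ?_⟩
  by_contra hLu
  have hpos : 0 < ‖L u‖ := norm_pos_iff.2 hLu
  obtain ⟨u', hu', hle⟩ := hsmall (‖L u‖ / 2) (half_pos hpos)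
  have h : ‖L u‖ ≤ ‖L u'‖ := hmin (show u' ∈ sphere (0 : F) 1 by simpa using hu')
  linarith

end Kernel

/-! ### An isolated limit point of a curve with compact tail is THE limit -/

/-- **Isolated limit point ⇒ convergence.**  A continuous curve with compact tail at `−∞` whose limit points lie in `N`
and which has a limit point `z₀` isolated in `N` converges to `z₀` (the limit set is preconnected, hence `{z₀}`).
[folklore; cf. Robinson1999 Ch. V Thm 4.1 (d)] -/
theorem tendsto_of_isolated_mapClusterPt {X : Type*} [MetricSpace X] {γ : ℝ → X} (hγ : Continuous γ)
    {K : Set X} (hK : IsCompact K) (hev : ∀ᶠ s in atBot, γ s ∈ K) {N : Set X}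
    (hN : ∀ z, MapClusterPt z atBot γ → z ∈ N) {z₀ : X} (hz₀ : MapClusterPt z₀ atBot γ) {r : ℝ} (hr : 0 < r)
    (hiso : ∀ y ∈ N, dist y z₀ < r → y = z₀) : Tendsto γ atBot (𝓝 z₀) := by
  have hpre := isPreconnected_setOf_mapClusterPt hγ hK hev
  refine hK.tendsto_nhds_of_unique_mapClusterPt hev fun z _ hz => ?_
  by_contra hne
  have hfar : r ≤ dist z z₀ := by
    by_contra h; exact hne (hiso z (hN z hz) (not_le.1 h))
  -- `U = B(z₀, r)`, `V = (B̄(z₀, r/2))ᶜ` cover the limit set, both meet it, but not jointly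
  have h := hpre (ball z₀ r) (closedBall z₀ (r / 2))ᶜ isOpen_ball isClosed_closedBall.isOpen_compl
    (fun w hw => ?_) ⟨z₀, hz₀, mem_ball_self hr⟩ ⟨z, hz, ?_⟩
  · obtain ⟨w, hw, hwU, hwV⟩ := h
    rw [mem_ball] at hwU
    rw [mem_compl_iff, mem_closedBall, not_le] at hwV
    have := hiso w (hN w hw) hwU
    rw [this, dist_self] at hwV
    linarith
  · by_cases hwr : dist w z₀ < r
    · exact Or.inl hwr
    · right
      rw [mem_compl_iff, mem_closedBall, not_le]
      linarith [not_lt.1 hwr]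
  · rw [mem_compl_iff, mem_closedBall, not_le]; linarith

/-! ### The bordered operator of a symmetric operator with simple kernel -/

section Symmetric

variable {E : Type*} [NormedAddCommGroup E] [InnerProductSpace ℝ E] [FiniteDimensional ℝ E]

/-- **Symmetric with simple kernel ⇒ the bordered operator is invertible.**  `L` symmetric, `L e = 0`, `‖e‖ = 1`, and
`ker L ∩ e^⊥ = 0`; then `L + ⟪e, ·⟫ e` is a linear homeomorphism. [folklore] -/
theorem exists_borderedEquiv_of_isSymmetric {L : E →L[ℝ] E} (hL : (L : E →ₗ[ℝ] E).IsSymmetric) {e : E}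
    (he : ‖e‖ = 1) (hLe : L e = 0) (hker : ∀ u : E, L u = 0 → ⟪e, u⟫ = 0 → u = 0) :
    ∃ T : E ≃L[ℝ] E, (T : E →L[ℝ] E) = L + (innerSL ℝ e).smulRight e := by
  set T' : E →L[ℝ] E := L + (innerSL ℝ e).smulRight e with hT'
  have hinj : Function.Injective T' := by
    refine (injective_iff_map_eq_zero T').2 fun u hu => ?_
    have hu' : L u + (⟪e, u⟫ : ℝ) • e = 0 := hu
    have h1 : (⟪e, u⟫ : ℝ) = 0 := by
      have h := congrArg (fun v => (⟪v, e⟫ : ℝ)) hu'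
      simp only [inner_add_left, inner_smul_left, inner_zero_left, real_inner_self_eq_norm_sq, he] at h
      have hsym : (⟪L u, e⟫ : ℝ) = ⟪u, L e⟫ := hL u e
      rw [hsym, hLe, inner_zero_right] at h
      simpa using h
    have h2 : L u = 0 := by rw [h1, zero_smul, add_zero] at hu'; exact hu'
    exact hker u h2 h1
  set Tl : E ≃ₗ[ℝ] E := (T' : E →ₗ[ℝ] E).linearEquivOfInjective hinj rfl with hTl
  exact ⟨Tl.toContinuousLinearEquiv, by ext u; rfl⟩

/-- **A bad symmetric operator on `ℝ³` has at most a simple kernel.**  Let `L` be symmetric on `ℝ³` with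
`tr L = 3γ`, `γ < ½`, `0 ≤ γ`, and let a unit `w` have `⟪L w, w⟫ ≥ 1 + γ`.  If `e` is a unit kernel vector then
`ker L ∩ e^⊥ = 0`: two orthonormal kernel vectors would force the third eigenvalue to be the trace `3γ < 1 + γ` and
`⟪Lw, w⟫ ≤ 3γ`.  (Spectral theorem: Mathlib `LinearMap.IsSymmetric.eigenvectorBasis`.) [folklore] -/
theorem ker_inter_orth_eq_zero_of_bad {L : EuclideanSpace ℝ (Fin 3) →L[ℝ] EuclideanSpace ℝ (Fin 3)}
    (hL : (L : EuclideanSpace ℝ (Fin 3) →ₗ[ℝ] EuclideanSpace ℝ (Fin 3)).IsSymmetric) {γ : ℝ} (hγ : 0 ≤ γ)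
    (hγ2 : γ < 1 / 2)
    (htr : LinearMap.trace ℝ _ (L : EuclideanSpace ℝ (Fin 3) →ₗ[ℝ] EuclideanSpace ℝ (Fin 3)) = 3 * γ)
    {w : EuclideanSpace ℝ (Fin 3)} (hw : ‖w‖ = 1) (hbad : 1 + γ ≤ ⟪L w, w⟫) {e : EuclideanSpace ℝ (Fin 3)}
    (he : ‖e‖ = 1) (hLe : L e = 0) :
    ∀ u : EuclideanSpace ℝ (Fin 3), L u = 0 → ⟪e, u⟫ = 0 → u = 0 := by
  classical
  intro u hLu heu
  by_contra hu0
  have hn : Module.finrank ℝ (EuclideanSpace ℝ (Fin 3)) = 3 := by simp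
  set b := hL.eigenvectorBasis hn with hb
  set ev : Fin 3 → ℝ := hL.eigenvalues hn with hev
  have hLb : ∀ i, L (b i) = ev i • b i := fun i => hL.apply_eigenvectorBasis hn i
  have hcoord : ∀ v i, (⟪b i, L v⟫ : ℝ) = ev i * ⟪b i, v⟫ := by
    intro v i
    have hsym := hL (b i) v
    simp only [ContinuousLinearMap.coe_coe] at hsym
    rw [← hsym, hLb, real_inner_smul_left]
  -- kernel vectors have coordinates supported where `ev = 0`
  have hkerc : ∀ v, L v = 0 → ∀ i, ev i ≠ 0 → (⟪b i, v⟫ : ℝ) = 0 := by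
    intro v hv i hi
    have h := hcoord v i
    rw [hv, inner_zero_right] at h
    exact (mul_eq_zero.1 h.symm).resolve_left hi
  -- `e` and `u' := u` are independent kernel vectors, so at least two eigenvalues vanish
  have htwo : ∃ i j : Fin 3, i ≠ j ∧ ev i = 0 ∧ ev j = 0 := by
    by_contra hno
    push Not at hno
    -- at most one index with `ev = 0`; all kernel vectors are multiples of that basis vector
    have hexp : ∀ v : EuclideanSpace ℝ (Fin 3), v = ∑ i, (⟪b i, v⟫ : ℝ) • b i :=
      fun v => (b.sum_repr' v).symm
    by_cases hex : ∃ i₀, ev i₀ = 0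
    · obtain ⟨i₀, hi₀⟩ := hex
      have hothers : ∀ i, i ≠ i₀ → ev i ≠ 0 := fun i hi h => hi (by
        by_contra hne; exact absurd (hno i i₀ hne h) (fun h' => h' hi₀))
      have hmul : ∀ v, L v = 0 → v = (⟪b i₀, v⟫ : ℝ) • b i₀ := by
        intro v hv
        conv_lhs => rw [hexp v]
        rw [← Finset.sum_erase_add _ _ (Finset.mem_univ i₀)]
        rw [Finset.sum_eq_zero fun i hi => ?_, zero_add]
        rw [hkerc v hv i (hothers i (Finset.ne_of_mem_erase hi)), zero_smul]
      have he' := hmul e hLe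
      have hu' := hmul u hLu
      have h1 : (⟪e, u⟫ : ℝ) = ⟪b i₀, e⟫ * ⟪b i₀, u⟫ := by
        conv_lhs => rw [he', hu']
        rw [real_inner_smul_left, real_inner_smul_right, real_inner_self_eq_norm_sq, b.orthonormal.1 i₀]
        ring
      have h2 : (⟪b i₀, e⟫ : ℝ) ≠ 0 := by
        intro h; rw [h, zero_smul] at he'; rw [he', norm_zero] at he; exact zero_ne_one he
      have h3 : (⟪b i₀, u⟫ : ℝ) = 0 := by
        rw [heu] at h1; exact (mul_eq_zero.1 h1.symm).resolve_left h2
      rw [h3, zero_smul] at hu'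
      exact hu0 hu'
    · push Not at hex
      have he' : e = 0 := by
        rw [hexp e]; exact Finset.sum_eq_zero fun i _ => by rw [hkerc e hLe i (hex i), zero_smul]
      rw [he', norm_zero] at he; exact zero_ne_one he
  obtain ⟨i, j, hij, hi, hj⟩ := htwo
  -- the third index `k` carries the trace: `ev k = 3γ`, and `⟪Lw, w⟫ = Σ ev_i ⟪b_i, w⟫² ≤ 3γ`
  have htrace : ∑ l, ev l = 3 * γ := by rw [← htr]; exact (hL.trace_eq_sum_eigenvalues hn).symm
  have hquad : (⟪L w, w⟫ : ℝ) = ∑ l, ev l * (⟪b l, w⟫ * ⟪b l, w⟫) := by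
    rw [← b.sum_inner_mul_inner (L w) w]
    refine Finset.sum_congr rfl fun l _ => ?_
    have hs : (⟪L w, b l⟫ : ℝ) = ev l * ⟪b l, w⟫ := by rw [← hcoord w l]; exact real_inner_comm _ _
    rw [hs]; ring
  have hnormsq : ∑ l, (⟪b l, w⟫ : ℝ) * ⟪b l, w⟫ = 1 := by
    have h := b.sum_inner_mul_inner w w
    rw [real_inner_self_eq_norm_sq, hw, one_pow] at h
    rw [← h]
    exact Finset.sum_congr rfl fun l _ => by congr 1; exact real_inner_comm _ _
  -- evaluate the sums over `Fin 3` by cases on `i, j`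
  have h3 : ∀ i j : Fin 3, i ≠ j → ∃ k : Fin 3, k ≠ i ∧ k ≠ j ∧ ∀ l : Fin 3, l = i ∨ l = j ∨ l = k := by decide
  obtain ⟨k, hki, hkj, hall⟩ := h3 i j hij
  have hsplit : ∀ f : Fin 3 → ℝ, ∑ l, f l = f i + f j + f k := by
    intro f
    have huniv : (Finset.univ : Finset (Fin 3)) = {i, j, k} := by
      ext l; simpa using hall l
    rw [huniv, Finset.sum_insert, Finset.sum_insert, Finset.sum_singleton]
    · ring
    · simpa using hkj.symm
    · simp only [Finset.mem_insert, Finset.mem_singleton, not_or]; exact ⟨hij, hki.symm⟩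
  have hle : (⟪L w, w⟫ : ℝ) ≤ 3 * γ := by
    rw [hquad, hsplit]
    rw [hsplit] at htrace hnormsq
    rw [hi, hj] at htrace ⊢
    have hk : ev k = 3 * γ := by linarith
    have hci := mul_self_nonneg (⟪b i, w⟫ : ℝ)
    have hcj := mul_self_nonneg (⟪b j, w⟫ : ℝ)
    have hck : (⟪b k, w⟫ : ℝ) * ⟪b k, w⟫ ≤ 1 := by linarith
    rw [hk]; nlinarith
  linarith

end Symmetric

/-- **Simple eigenvalue `0` with a second known eigenvector ⇒ the bordered operator is invertible** (`ℝ³`).  If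
`A ω = λ ω` (`ω ≠ 0`, `λ ≠ 0`), `A e = 0` (`‖e‖ = 1`) and `tr A ≠ λ` up to the third diagonal entry — precisely
`tr A − λ ≠ 0` — then `A + ⟪e, ·⟫ e` is a linear homeomorphism: in a basis `(f, ω, e)` the `f`-coordinate of `A f` is
`μ = tr A − λ ≠ 0`, so `(A + ⟪e,·⟫e) u = 0` kills the `f`-coordinate of `u`, then `ω, e`-independence finishes.  The case
of a VORTICAL in-window stagnation point: `A = DW(z)`, `ω = curl V(z)`, `λ = 1 + γ`, `tr A = 3γ`, `μ = 2γ − 1`.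
[folklore] -/
theorem exists_borderedEquiv_of_eigen_simple (A : EuclideanSpace ℝ (Fin 3) →L[ℝ] EuclideanSpace ℝ (Fin 3))
    {om e : EuclideanSpace ℝ (Fin 3)} (hom : om ≠ 0) (he : ‖e‖ = 1) {lam t : ℝ} (hlam : lam ≠ 0)
    (hAom : A om = lam • om) (hAe : A e = 0)
    (htr : LinearMap.trace ℝ _ (A : EuclideanSpace ℝ (Fin 3) →ₗ[ℝ] EuclideanSpace ℝ (Fin 3)) = t)
    (hμ : t - lam ≠ 0) :
    ∃ T : EuclideanSpace ℝ (Fin 3) ≃L[ℝ] EuclideanSpace ℝ (Fin 3),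
      (T : EuclideanSpace ℝ (Fin 3) →L[ℝ] EuclideanSpace ℝ (Fin 3)) = A + (innerSL ℝ e).smulRight e := by
  classical
  have he0 : e ≠ 0 := by intro h; rw [h, norm_zero] at he; exact zero_ne_one he
  -- `om, e` are independent
  have hpair : ∀ s r : ℝ, s • om + r • e = 0 → s = 0 ∧ r = 0 := by
    intro s r h
    have h1 : s * lam = 0 := by
      have h2 := congrArg A h
      rw [map_add, map_smul, map_smul, hAom, hAe, smul_zero, add_zero, map_zero, smul_smul] at h2
      exact smul_eq_zero.1 h2 |>.resolve_right hom
    have hs : s = 0 := (mul_eq_zero.1 h1).resolve_right hlam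
    rw [hs, zero_smul, zero_add] at h
    exact ⟨hs, (smul_eq_zero.1 h).resolve_right he0⟩
  have hli2 : LinearIndependent ℝ ![om, e] := by
    rw [LinearIndependent.pair_iff]
    exact hpair
  -- a third vector outside the plane
  obtain ⟨f, hf⟩ : ∃ f : EuclideanSpace ℝ (Fin 3), f ∉ Submodule.span ℝ (Set.range ![om, e]) := by
    by_contra h
    push Not at h
    have htop : Submodule.span ℝ (Set.range ![om, e]) = ⊤ := Submodule.eq_top_iff'.2 h
    have h1 := finrank_range_le_card (R := ℝ) ![om, e]
    rw [Set.finrank, htop, finrank_top, finrank_euclideanSpace, Fintype.card_fin, Fintype.card_fin] at h1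
    omega
  have hli3 : LinearIndependent ℝ (Fin.cons f ![om, e]) := (linearIndependent_finCons).2 ⟨hli2, hf⟩
  have hcard : Fintype.card (Fin 3) = Module.finrank ℝ (EuclideanSpace ℝ (Fin 3)) := by simp
  set b : Module.Basis (Fin 3) ℝ (EuclideanSpace ℝ (Fin 3)) := basisOfLinearIndependentOfCardEqFinrank hli3 hcard
    with hbdef
  have hb0 : b 0 = f := by rw [hbdef, coe_basisOfLinearIndependentOfCardEqFinrank]; rfl
  have hb1 : b 1 = om := by rw [hbdef, coe_basisOfLinearIndependentOfCardEqFinrank]; rfl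
  have hb2 : b 2 = e := by rw [hbdef, coe_basisOfLinearIndependentOfCardEqFinrank]; rfl
  -- coordinates
  have hrom : b.repr om 0 = 0 := by
    rw [← hb1, b.repr_self]; simp
  have hre : b.repr e 0 = 0 := by
    rw [← hb2, b.repr_self]; simp
  set μ : ℝ := b.repr (A f) 0 with hμdef
  -- trace in the basis `b`: `t = μ + lam`
  have htrace : t = μ + lam := by
    rw [← htr, LinearMap.trace_eq_matrix_trace ℝ b, Matrix.trace, Fin.sum_univ_three]
    simp only [Matrix.diag_apply, LinearMap.toMatrix_apply, ContinuousLinearMap.coe_coe, hb0, hb1, hb2, hAom, hAe,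
      map_smul, map_zero, Finsupp.smul_apply, smul_eq_mul, Finsupp.coe_zero, Pi.zero_apply, add_zero]
    rw [← hb1, b.repr_self]
    simp [hμdef]
  have hμne : μ ≠ 0 := by
    intro h; apply hμ; rw [htrace, h]; ring
  -- injectivity of the bordered operator
  set T' : EuclideanSpace ℝ (Fin 3) →L[ℝ] EuclideanSpace ℝ (Fin 3) := A + (innerSL ℝ e).smulRight e with hT'
  have hinj : Function.Injective T' := by
    refine (injective_iff_map_eq_zero T').2 fun u hu => ?_
    have hu' : A u + (⟪e, u⟫ : ℝ) • e = 0 := hu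
    -- expand `u` in the basis
    have hexp : u = b.repr u 0 • f + b.repr u 1 • om + b.repr u 2 • e := by
      conv_lhs => rw [← b.sum_repr u]
      rw [Fin.sum_univ_three, hb0, hb1, hb2]
    -- the `f`-coordinate of `T u` is `μ · (b.repr u 0)`
    have hc0 : b.repr u 0 = 0 := by
      have h1 : A u = b.repr u 0 • A f + (b.repr u 1 * lam) • om := by
        conv_lhs => rw [hexp]
        rw [map_add, map_add, map_smul, map_smul, map_smul, hAom, hAe, smul_zero, add_zero, smul_smul]
      have h2 := congrArg (fun v => b.repr v 0) hu'
      simp only [map_add, map_smul, Finsupp.add_apply, Finsupp.smul_apply, smul_eq_mul, h1, hrom, hre,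
        map_zero, Finsupp.coe_zero, Pi.zero_apply, mul_zero, add_zero] at h2
      exact (mul_eq_zero.1 h2).resolve_right hμne
    have hexp' : u = b.repr u 1 • om + b.repr u 2 • e := by
      conv_lhs => rw [hexp]
      rw [hc0, zero_smul, zero_add]
    have hAu : A u = (b.repr u 1 * lam) • om := by
      conv_lhs => rw [hexp']
      rw [map_add, map_smul, map_smul, hAom, hAe, smul_zero, add_zero, smul_smul]
    rw [hAu] at hu'
    obtain ⟨h1, h2⟩ := hpair _ _ hu'
    have hc1 : b.repr u 1 = 0 := (mul_eq_zero.1 h1).resolve_right hlam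
    rw [hc1, zero_smul, zero_add] at hexp'
    have h3 : (⟪e, u⟫ : ℝ) = b.repr u 2 := by
      conv_lhs => rw [hexp']
      rw [inner_smul_right, real_inner_self_eq_norm_sq, he]; ring
    rw [h2] at h3
    rw [hexp', ← h3, zero_smul]
  set Tl := (T' : EuclideanSpace ℝ (Fin 3) →ₗ[ℝ] EuclideanSpace ℝ (Fin 3)).linearEquivOfInjective hinj rfl
  exact ⟨Tl.toContinuousLinearEquiv, by ext u; rfl⟩


end Summit.NavierStokesRegularity.NavierStokesRegularity.Theorems.PowerGaugeEulerLiouville.NoDrift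

end
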